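import Mathlib
import HarnessLib
import Summits.NavierStokesRegularity.NavierStokesRegularity.Theorems.HalfSpaceWindowDoorCirculationCarryingRigidityDefs
import Summits.NavierStokesRegularity.NavierStokesRegularity.Theorems.HalfSpaceWindowDoorCirculationCarryingRigidityReduction
import Summits.NavierStokesRegularity.NavierStokesRegularity.Theorems.HalfSpaceWindowDoorCirculationCarryingRigidityCriticalStretchingAnalytic
import Summits.NavierStokesRegularity.NavierStokesRegularity.Theorems.HalfSpaceWindowDoorCirculationCarryingRigidityWindowedFlux
import Literature.Analysis.UnboundedOperators.HeatKernelBoundedData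
import Literature.Analysis.FluidPDE.AxisymNoSwirlVorticity
import Summits.NavierStokesRegularity.NavierStokesRegularity.Theorems.HalfSpaceWindowDoorCirculationCarryingRigidityPlaneFluxDynamics
import Summits.NavierStokesRegularity.NavierStokesRegularity.Theorems.HalfSpaceWindowDoorCirculationCarryingRigidityTiltingIdentity
import Summits.NavierStokesRegularity.NavierStokesRegularity.Theorems.HalfSpaceWindowDoorCirculationCarryingRigidityTiltingFlux
import Literature.Analysis.UnboundedOperators.HeatKernelHeatEquation
import Literature.Analysis.UnboundedOperators.HeatFlowCalculus
import Literature.Analysis.UnboundedOperators.HeatExtensionHarnack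
import Literature.Analysis.UnboundedOperators.HeatKernelGradient
import Literature.Analysis.UnboundedOperators.HeatKernelReversePoincare
import Literature.Analysis.FluidPDE.AxisymNoSwirlImpulseSlice
import Literature.Analysis.FluidPDE.AxisymHouLiVariables
import Literature.Analysis.Calculus.IicRpowTails
import Literature.Analysis.FluidPDE.ConstantinFeffermanStretching
import Summits.NavierStokesRegularity.NavierStokesRegularity.Theorems.PoloidalWindowDoorPoloidalWindowRigidityScrewKinematics
import Summits.NavierStokesRegularity.NavierStokesRegularity.Theorems.HalfSpaceWindowDoorCirculationCarryingRigidityGaussKernel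
import Summits.NavierStokesRegularity.NavierStokesRegularity.Theorems.HalfSpaceWindowDoorCirculationCarryingRigidityGaussCirculation
import Summits.NavierStokesRegularity.NavierStokesRegularity.Theorems.HalfSpaceWindowDoorCirculationCarryingRigidityGaussStein
import Summits.NavierStokesRegularity.NavierStokesRegularity.Theorems.HalfSpaceWindowDoorCirculationCarryingRigidityGaussTilting

/-!
# Route `HalfSpaceWindowDoor`, crux `CirculationCarryingRigidity` (stmt-NavierStokesRegularity-25311) — line «gauss-swirl»,
# part `GaussVorticityLaw`: the DYNAMIC Gaussian vorticity law on the door class: `d/ds ∫ G_{s₀−s}(x−x₀) ω₃(s) = ∫ ∂₀G F₀ + ∫ ∂₁G F₁`,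
`Fⱼ = vⱼω₃ − ωⱼv₃` (`hasDerivAt_gaussVorticity_time` for classical vorticity solutions with uniform bounds on a time
neighbourhood — differentiation inside the Bochner integral with the explicit Gaussian dominator `e^{−‖x−x₀‖²/16(s₀−s)}` — and
`hasDerivAt_gaussVorticity_of_class` for the route's Type-I ancient Oseen-mild class)

LINE «gauss-swirl» = ideator ns-idea-4 g11 (D-0145, files-only; critic of record idea-crit-3: PASS, grade new-combination on the wall W6
`…Defs.HemisphereLiouvilleE3`), file of record `pub/ideators/ns-idea-4/lines/gauss-swirl/GaussSwirl_v1_4.lean` (sha16 9f36760ac8cb3b0a,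
`lean check` rc 0, sorries 1 = the research statement K1 only), card `LINE-gauss-swirl_v1_4.md`, PORT-MAP.md 5a0f471fb69fa47f.  PORTED
INTO THE TREE by the LEAD of 25311 (ns-hsw-p1 g6, cell pub-ns-dss) as census support `--supports stmt-NavierStokesRegularity-25311
--as helper`: the proof texts below are the ideator's, VERBATIM modulo the split into ≤ 400-line modules, the `E3 ↦ EuclideanSpace ℝ
(Fin 3)` spelling, the namespace, added one-line docstrings and two `_`-renamings for the unused-variable linter; the vocabulary
(`InDoorClass`, `SignE3`, `gauss`, `angMom`, `gaussAngMom` = 𝒢, `gaussInflow` = ℐ, and the obligation / stratum Props) lives in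
`…CirculationCarryingRigidityDefs`.

THE LINE IN ONE PARAGRAPH.  2D one-signed vorticity has the exact law `d/dt∫|x|²ω = 4νΦ`, which alone kills ancient flows with `Φ > 0`;
in the 3D closed hemisphere (`ω₃ ≥ 0`) it survives for the GAUSSIAN AXIAL ANGULAR MOMENTUM `𝒢(t;x₀) = t^{-3/2}∫e^{−|x−x₀|²/4t} g`
(`= 2t^{-1/2}∫e^{…}ω₃ ≥ 0`), because against the divergence-free Gaussian swirl field `K_t(x−x₀)·e₃×(x−x₀)` pressure AND vortex tilting
drop out exactly, leaving ONE signed residue, the inflow correlation `ℐ = t^{-3/2}∫e^{…}((x−x₀)·v) g`: `d𝒢/ds = −𝒢/(s₀−s) − ℐ/(2(s₀−s))`;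
with the time-only Type-I rate `𝒢/(s₀−s) → 0` in the far past, so «no inflow about ONE space–time axis before some epoch ⇒ poloidal».

WHAT THIS IS NOT: not a statement about Navier–Stokes regularity (Clay A).  The door statements are regularity CRITERIA about
HYPOTHETICAL blow-up profiles (KNSS ancient mild solutions); the research statement K1 `PersistentAxis` (⟺ the wall) is NOT proved,
NOT registered and nothing is closed by this file; item 25311 stays OPEN at its research stub.
-/

noncomputable section

-- the summit and its single sub-problem share the name (CONVENTIONS §1), as in every Theorems file
set_option linter.dupNamespace false

namespace Summit.NavierStokesRegularity.NavierStokesRegularity.Theorems.HalfSpaceWindowDoorCirculationCarryingRigidityGaussVorticityLaw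


open scoped BigOperators Topology MeasureTheory InnerProductSpace RealInnerProductSpace Laplacian ContDiff
open Filter Set Function MeasureTheory Metric
open Literature.Analysis Literature.Analysis.FluidPDE Literature.Analysis.UnboundedOperators
open Summit.NavierStokesRegularity.NavierStokesRegularity.Theses.HalfSpaceWindowDoor
open Summit.NavierStokesRegularity.NavierStokesRegularity.Theorems.HalfSpaceWindowDoorCirculationCarryingRigidityDefs
open Summit.NavierStokesRegularity.NavierStokesRegularity.Theorems.HalfSpaceWindowDoorCirculationCarryingRigidityReduction
  (circulationCarryingRigidity_of_hemisphereLiouvilleE3)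
open Summit.NavierStokesRegularity.NavierStokesRegularity.Theorems.HalfSpaceWindowDoorCirculationCarryingRigidityCriticalStretchingAnalytic
  (inner_curl_e3_eq_zero_of_far_past)
open Summit.NavierStokesRegularity.NavierStokesRegularity.Theorems.LocalSineTubeDoorProfileAlignedWindowRigidityAncient
  (bdd_of_hasTypeITimeDecay analyticOnNhd_slice)
open Summit.NavierStokesRegularity.NavierStokesRegularity.Theorems.PoloidalWindowDoorPoloidalWindowRigidityClassSpaceTimeRates
  (exists_fderiv_rate_of_class' exists_iteratedFDeriv_two_rate_of_class' exists_iteratedFDeriv_three_rate_of_class)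
open Summit.NavierStokesRegularity.NavierStokesRegularity.Theorems.HalfSpaceWindowDoorCirculationCarryingRigidityPlaneFluxDynamics
  (hasDerivAt_inner_curl_e3_convect)
open Summit.NavierStokesRegularity.NavierStokesRegularity.Theorems.HalfSpaceWindowDoorCirculationCarryingRigidityTiltingIdentity
  (convect_sub_stretch_two_eq_divh)
open Summit.NavierStokesRegularity.NavierStokesRegularity.Theorems.HalfSpaceWindowDoorCirculationCarryingRigidityTiltingFlux
  (contDiff_flux norm_flux_le norm_fderiv_flux_le)
open Summit.NavierStokesRegularity.NavierStokesRegularity.Theorems.HalfSpaceWindowDoorCirculationCarryingRigiditySubcriticalStretching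
  (hasDerivAt_inner_curl_e3 fderiv_inner_e3_apply laplacian_inner_e3)
open Summit.NavierStokesRegularity.NavierStokesRegularity.Theorems.HalfSpaceWindowDoorCirculationCarryingRigidityPlaneFluxHeightWindow
  (abs_inner_e3_le contDiff_one_curl)
open Summit.NavierStokesRegularity.NavierStokesRegularity.Theorems.HalfSpaceWindowDoorCirculationCarryingRigidityPlaneLaplacian
  (contDiff_two_curl norm_iteratedFDeriv_two_inner_e3_le)
open Summit.NavierStokesRegularity.NavierStokesRegularity.Theorems.ChiralWindowDoorClassDerivDecay (exists_classical_of_class)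
open Summit.NavierStokesRegularity.NavierStokesRegularity.Theorems.PoloidalWindowDoorPoloidalWindowRigidityScrewKinematics (inner_eq_three)
open Summit.NavierStokesRegularity.NavierStokesRegularity.Theorems.HalfSpaceWindowDoorCirculationCarryingRigidityGaussKernel
open Summit.NavierStokesRegularity.NavierStokesRegularity.Theorems.HalfSpaceWindowDoorCirculationCarryingRigidityGaussCirculation
open Summit.NavierStokesRegularity.NavierStokesRegularity.Theorems.HalfSpaceWindowDoorCirculationCarryingRigidityGaussStein
open Summit.NavierStokesRegularity.NavierStokesRegularity.Theorems.HalfSpaceWindowDoorCirculationCarryingRigidityGaussTilting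

section Dynamic
variable {v : ℝ → (EuclideanSpace ℝ (Fin 3)) → (EuclideanSpace ℝ (Fin 3))}

/-- **DYNAMIC GAUSSIAN VORTICITY LAW** (moving backward heat-kernel window).  For a solution of the vorticity formulation on
`(−∞,0)` with the velocity, its gradient, the vorticity and its first two derivatives uniformly bounded on a time
neighbourhood of `s < 0`, and `s < s₀`: `σ ↦ ∫ G_{s₀−σ}(x − x₀) ω₃(σ,x) dx` is differentiable at `s` with derivative
`∫ ∂₀G F₀ + ∫ ∂₁G F₁` (`G = G_{s₀−s}(· − x₀)`, `Fⱼ = vⱼω₃ − ωⱼv₃` at time `s`): the caloric part `∫ (−∂ₜG) ω₃ + ∫ G Δω₃`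
cancels exactly (Green), the transport–tilting part is one integration by parts. -/
theorem hasDerivAt_gaussVorticity_time (hV : IsVorticitySolutionOn (Iio (0 : ℝ)) 1 v) {s δ s₀ : ℝ} (hδ : 0 < δ)
    (hδs : s + δ < 0) (hs₀ : s < s₀) (hδt : 2 * δ ≤ s₀ - s) {Bu Mu Bw Mw Mw2 : ℝ}
    (hBu : ∀ σ ∈ Ioo (s - δ) (s + δ), ∀ x, ‖v σ x‖ ≤ Bu)
    (hMu : ∀ σ ∈ Ioo (s - δ) (s + δ), ∀ x, ‖fderiv ℝ (v σ) x‖ ≤ Mu)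
    (hBw : ∀ σ ∈ Ioo (s - δ) (s + δ), ∀ x, ‖curl (v σ) x‖ ≤ Bw)
    (hMw : ∀ σ ∈ Ioo (s - δ) (s + δ), ∀ x, ‖fderiv ℝ (curl (v σ)) x‖ ≤ Mw)
    (hMw2 : ∀ σ ∈ Ioo (s - δ) (s + δ), ∀ x, ‖iteratedFDeriv ℝ 2 (curl (v σ)) x‖ ≤ Mw2)
    (x₀ : (EuclideanSpace ℝ (Fin 3))) :
    HasDerivAt (fun σ => ∫ x, heatKernel (s₀ - σ) (x - x₀) * ⟪curl (v σ) x, e3⟫)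
      ((∫ x, fderiv ℝ (fun y : (EuclideanSpace ℝ (Fin 3)) => heatKernel (s₀ - s) (y - x₀)) x (EuclideanSpace.single 0 1) *
            (v s x 0 * curl (v s) x 2 - curl (v s) x 0 * v s x 2)) +
        ∫ x, fderiv ℝ (fun y : (EuclideanSpace ℝ (Fin 3)) => heatKernel (s₀ - s) (y - x₀)) x (EuclideanSpace.single 1 1) *
            (v s x 1 * curl (v s) x 2 - curl (v s) x 1 * v s x 2)) s := by
  have hs : s < 0 := by linarith
  have ht : 0 < s₀ - s := by linarith
  have hsI : s ∈ Ioo (s - δ) (s + δ) := ⟨by linarith, by linarith⟩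
  have hIneg : ∀ σ ∈ Ioo (s - δ) (s + δ), σ < 0 := fun σ hσ => lt_trans hσ.2 hδs
  have hIs₀ : ∀ σ ∈ Ioo (s - δ) (s + δ), σ < s₀ := fun σ hσ => by linarith [hσ.2]
  have hIcc : ∀ σ ∈ Ioo (s - δ) (s + δ), s₀ - σ ∈ Icc ((s₀ - s) / 2) (2 * (s₀ - s)) := fun σ hσ =>
    ⟨by linarith [hσ.2], by linarith [hσ.1]⟩
  have hu : IsSmoothSpaceTimeOn (Iio (0 : ℝ)) v := hV.smooth_velocity
  have hω : IsSmoothSpaceTimeOn (Iio (0 : ℝ)) (vorticity v) := hu.isSmoothSpaceTimeOn_vorticity isOpen_Iio.uniqueDiffOn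
  have hvs : ∀ σ < (0 : ℝ), ContDiff ℝ ∞ (v σ) := fun σ hσ => hu.contDiff_slice hσ
  have hωs : ∀ σ < (0 : ℝ), ContDiff ℝ ∞ (curl (v σ)) := fun σ hσ => hω.contDiff_slice hσ
  have hω2 : ∀ σ < (0 : ℝ), ContDiff ℝ 2 (curl (v σ)) := fun σ hσ => (hωs σ hσ).of_le (by norm_cast)
  have hf2 : ∀ σ < (0 : ℝ), ContDiff ℝ 2 (fun z => ⟪curl (v σ) z, e3⟫) := fun σ hσ => (hω2 σ hσ).inner ℝ contDiff_const
  -- the pointwise rate of `ω₃` and its bound on the neighbourhood (as in `…PlaneFluxDynamics`)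
  set D : ℝ → (EuclideanSpace ℝ (Fin 3)) → ℝ := fun σ x =>
    (Δ fun z => ⟪curl (v σ) z, e3⟫) x - (convect (v σ) (curl (v σ)) x 2 - convect (curl (v σ)) (v σ) x 2) with hD
  set B : ℝ := 3 * Mw2 + (Mw * Bu + Mu * Bw) with hB
  have hDb : ∀ σ ∈ Ioo (s - δ) (s + δ), ∀ x, |D σ x| ≤ B := by
    intro σ hσ x
    have hσ0 := hIneg σ hσ
    have h1 : |(Δ fun z => ⟪curl (v σ) z, e3⟫) x| ≤ 3 * Mw2 := by
      rw [← Real.norm_eq_abs]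
      calc ‖(Δ fun z => ⟪curl (v σ) z, e3⟫) x‖ ≤ 3 * ‖iteratedFDeriv ℝ 2 (fun z => ⟪curl (v σ) z, e3⟫) x‖ :=
            norm_laplacian_le_three_mul_norm_iteratedFDeriv_two (hf2 σ hσ0) x
        _ ≤ 3 * ‖iteratedFDeriv ℝ 2 (curl (v σ)) x‖ := by gcongr; exact norm_iteratedFDeriv_two_inner_e3_le (hω2 σ hσ0) x
        _ ≤ 3 * Mw2 := by gcongr; exact hMw2 σ hσ x
    have h2 : |convect (v σ) (curl (v σ)) x 2| ≤ Mw * Bu := by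
      rw [convect_apply, ← Real.norm_eq_abs]
      calc ‖fderiv ℝ (curl (v σ)) x (v σ x) 2‖ ≤ ‖fderiv ℝ (curl (v σ)) x (v σ x)‖ := PiLp.norm_apply_le _ _
        _ ≤ ‖fderiv ℝ (curl (v σ)) x‖ * ‖v σ x‖ := ContinuousLinearMap.le_opNorm _ _
        _ ≤ Mw * Bu := mul_le_mul (hMw σ hσ x) (hBu σ hσ x) (norm_nonneg _) ((norm_nonneg _).trans (hMw σ hσ x))
    have h3 : |convect (curl (v σ)) (v σ) x 2| ≤ Mu * Bw := by
      rw [convect_apply, ← Real.norm_eq_abs]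
      calc ‖fderiv ℝ (v σ) x (curl (v σ) x) 2‖ ≤ ‖fderiv ℝ (v σ) x (curl (v σ) x)‖ := PiLp.norm_apply_le _ _
        _ ≤ ‖fderiv ℝ (v σ) x‖ * ‖curl (v σ) x‖ := ContinuousLinearMap.le_opNorm _ _
        _ ≤ Mu * Bw := mul_le_mul (hMu σ hσ x) (hBw σ hσ x) (norm_nonneg _) ((norm_nonneg _).trans (hMu σ hσ x))
    simp only [hD]
    calc |(Δ fun z => ⟪curl (v σ) z, e3⟫) x - (convect (v σ) (curl (v σ)) x 2 - convect (curl (v σ)) (v σ) x 2)|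
        ≤ |(Δ fun z => ⟪curl (v σ) z, e3⟫) x| + |convect (v σ) (curl (v σ)) x 2 - convect (curl (v σ)) (v σ) x 2| := abs_sub _ _
      _ ≤ |(Δ fun z => ⟪curl (v σ) z, e3⟫) x| + (|convect (v σ) (curl (v σ)) x 2| + |convect (curl (v σ)) (v σ) x 2|) := by
          gcongr; exact abs_sub _ _
      _ ≤ 3 * Mw2 + (Mw * Bu + Mu * Bw) := add_le_add h1 (add_le_add h2 h3)
  have hB0 : 0 ≤ B := (abs_nonneg _).trans (hDb s hsI x₀)
  have hBw0 : 0 ≤ Bw := (norm_nonneg _).trans (hBw s hsI x₀)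
  -- Gaussian majorants of the moving window and of its time derivative on `s₀ − σ ∈ [t/2, 2t]`
  obtain ⟨Ctw, hCtw0, hCtw⟩ := exists_abs_timeWeight_mul_heatKernel_le (E := (EuclideanSpace ℝ (Fin 3))) ht
  set A : ℝ := (4 * Real.pi * ((s₀ - s) / 2)) ^ (-(Module.finrank ℝ (EuclideanSpace ℝ (Fin 3)) : ℝ) / 2) with hA
  have hA0 : 0 ≤ A := by rw [hA]; positivity
  set gauss16 : (EuclideanSpace ℝ (Fin 3)) → ℝ := fun x => Real.exp (-(1 / (16 * (s₀ - s))) * ‖x - x₀‖ ^ 2) with hg16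
  have hg16_int : Integrable gauss16 := by
    have h := (integrable_gaussian_of_pos (E := (EuclideanSpace ℝ (Fin 3))) (by positivity : 0 < 1 / (16 * (s₀ - s)))).comp_sub_right x₀
    exact h
  have hKle : ∀ σ ∈ Ioo (s - δ) (s + δ), ∀ x, heatKernel (s₀ - σ) (x - x₀) ≤ A * gauss16 x := by
    intro σ hσ x
    refine (heatKernel_le_of_mem_Icc (E := (EuclideanSpace ℝ (Fin 3))) ht (hIcc σ hσ) (x - x₀)).trans ?_
    simp only [hg16, hA]
    refine mul_le_mul_of_nonneg_left (Real.exp_le_exp.2 ?_) (by positivity)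
    have hn : 0 ≤ ‖x - x₀‖ ^ 2 := by positivity
    have h16 : (1 / (16 * (s₀ - s))) ≤ 1 / (8 * (s₀ - s)) := one_div_le_one_div_of_le (by positivity) (by linarith)
    nlinarith
  have htwle : ∀ σ ∈ Ioo (s - δ) (s + δ), ∀ x,
      |(‖x - x₀‖ ^ 2 / (4 * (s₀ - σ) ^ 2) - (3 : ℝ) / (2 * (s₀ - σ))) * heatKernel (s₀ - σ) (x - x₀)| ≤ Ctw * gauss16 x := by
    intro σ hσ x
    have h := hCtw (s₀ - σ) (hIcc σ hσ) (x - x₀)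
    rw [finrank_euclideanSpace_fin] at h
    push_cast at h
    rw [abs_mul, abs_of_nonneg (heatKernel_pos (by linarith [(hIcc σ hσ).1]) _).le]
    simpa only [hg16] using h
  -- the integrand, its derivative, measurability and integrability
  set F : ℝ → (EuclideanSpace ℝ (Fin 3)) → ℝ := fun σ x => heatKernel (s₀ - σ) (x - x₀) * ⟪curl (v σ) x, e3⟫ with hF
  set F' : ℝ → (EuclideanSpace ℝ (Fin 3)) → ℝ := fun σ x =>
    -((‖x - x₀‖ ^ 2 / (4 * (s₀ - σ) ^ 2) - (3 : ℝ) / (2 * (s₀ - σ))) * heatKernel (s₀ - σ) (x - x₀)) * ⟪curl (v σ) x, e3⟫ +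
      heatKernel (s₀ - σ) (x - x₀) * D σ x with hF'
  have hfc : ∀ σ < (0 : ℝ), Continuous (fun x => ⟪curl (v σ) x, e3⟫) := fun σ hσ =>
    (hωs σ hσ).continuous.inner continuous_const
  have hFc : ∀ σ < (0 : ℝ), Continuous (F σ) := fun σ hσ => (continuous_G x₀ (s₀ - σ)).mul (hfc σ hσ)
  have hDc : Continuous (D s) := by
    have hΔ : Continuous (Δ fun z => ⟪curl (v s) z, e3⟫) := continuous_laplacian (hf2 s hs)
    have hc1 : Continuous fun x => convect (v s) (curl (v s)) x 2 := by
      have h : Continuous fun x => convect (v s) (curl (v s)) x := by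
        simp_rw [convect_apply]
        exact ((hω2 s hs).continuous_fderiv two_ne_zero).clm_apply (hvs s hs).continuous
      exact (EuclideanSpace.proj (𝕜 := ℝ) (2 : Fin 3)).continuous.comp h
    have hc2 : Continuous fun x => convect (curl (v s)) (v s) x 2 := by
      have h : Continuous fun x => convect (curl (v s)) (v s) x := by
        simp_rw [convect_apply]
        exact ((hvs s hs).continuous_fderiv (by simp)).clm_apply (hω2 s hs).continuous
      exact (EuclideanSpace.proj (𝕜 := ℝ) (2 : Fin 3)).continuous.comp h
    simp only [hD]
    exact hΔ.sub (hc1.sub hc2)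
  have htwc : Continuous fun x : (EuclideanSpace ℝ (Fin 3)) =>
      (‖x - x₀‖ ^ 2 / (4 * (s₀ - s) ^ 2) - (3 : ℝ) / (2 * (s₀ - s))) * heatKernel (s₀ - s) (x - x₀) := by
    refine Continuous.mul ?_ (continuous_G x₀ (s₀ - s))
    fun_prop
  have hF'c : Continuous (F' s) := by
    simp only [hF']
    exact (htwc.neg.mul (hfc s hs)).add ((continuous_G x₀ (s₀ - s)).mul hDc)
  have hf0 : ∀ z, ‖⟪curl (v s) z, e3⟫‖ ≤ Bw := fun z => by
    rw [Real.norm_eq_abs]; exact (abs_inner_e3_le _).trans (hBw s hsI z)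
  have hFint : Integrable (F s) :=
    (integrable_G x₀ ht).mul_bdd (hfc s hs).aestronglyMeasurable (ae_of_all _ hf0)
  have hball : ball s δ = Ioo (s - δ) (s + δ) := Real.ball_eq_Ioo s δ
  have hmeas : ∀ᶠ σ in 𝓝 s, AEStronglyMeasurable (F σ) volume := by
    filter_upwards [Iio_mem_nhds hs] with σ hσ using (hFc σ hσ).aestronglyMeasurable
  have hbound : ∀ᵐ x ∂(volume : Measure (EuclideanSpace ℝ (Fin 3))), ∀ σ ∈ ball s δ, ‖F' σ x‖ ≤ (Ctw * Bw + A * B) * gauss16 x := by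
    refine ae_of_all _ fun x σ hσ => ?_
    rw [hball] at hσ
    simp only [hF']
    have hg0 : 0 ≤ gauss16 x := (Real.exp_pos _).le
    have e1 : ‖-((‖x - x₀‖ ^ 2 / (4 * (s₀ - σ) ^ 2) - (3 : ℝ) / (2 * (s₀ - σ))) * heatKernel (s₀ - σ) (x - x₀)) *
        ⟪curl (v σ) x, e3⟫‖ ≤ Ctw * gauss16 x * Bw := by
      rw [norm_mul, norm_neg, Real.norm_eq_abs, Real.norm_eq_abs]
      exact mul_le_mul (htwle σ hσ x) ((abs_inner_e3_le _).trans (hBw σ hσ x)) (abs_nonneg _) (by positivity)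
    have e2 : ‖heatKernel (s₀ - σ) (x - x₀) * D σ x‖ ≤ A * gauss16 x * B := by
      rw [norm_mul, Real.norm_eq_abs, Real.norm_eq_abs,
        abs_of_nonneg (heatKernel_pos (by linarith [(hIcc σ hσ).1]) _).le]
      exact mul_le_mul (hKle σ hσ x) (hDb σ hσ x) (abs_nonneg _) (by positivity)
    calc _ ≤ Ctw * gauss16 x * Bw + A * gauss16 x * B := (norm_add_le _ _).trans (add_le_add e1 e2)
      _ = (Ctw * Bw + A * B) * gauss16 x := by ring
  have hdiff : ∀ᵐ x ∂(volume : Measure (EuclideanSpace ℝ (Fin 3))), ∀ σ ∈ ball s δ, HasDerivAt (fun σ' => F σ' x) (F' σ x) σ := by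
    refine ae_of_all _ fun x σ hσ => ?_
    rw [hball] at hσ
    have h : HasDerivAt (fun σ' => heatKernel (s₀ - σ') (x - x₀) * ⟪curl (v σ') x, e3⟫)
        (-((‖x - x₀‖ ^ 2 / (4 * (s₀ - σ) ^ 2) - (3 : ℝ) / (2 * (s₀ - σ))) * heatKernel (s₀ - σ) (x - x₀)) *
            ⟪curl (v σ) x, e3⟫ +
          heatKernel (s₀ - σ) (x - x₀) *
            ((Δ fun z => ⟪curl (v σ) z, e3⟫) x - (convect (v σ) (curl (v σ)) x 2 - convect (curl (v σ)) (v σ) x 2))) σ :=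
      (hasDerivAt_G_backward (hIs₀ σ hσ) (x - x₀)).mul (hasDerivAt_inner_curl_e3_convect hV (hIneg σ hσ) x)
    simp only [hF, hF', hD]
    exact h
  have hD' := (hasDerivAt_integral_of_dominated_loc_of_deriv_le (μ := volume) (F := F) (F' := F') (x₀ := s)
    (s := ball s δ) (ball_mem_nhds s hδ) hmeas hFint hF'c.aestronglyMeasurable hbound
    (hg16_int.const_mul _) hdiff).2
  -- the value of the derivative
  have hv1 : ContDiff ℝ 1 (v s) := (hvs s hs).of_le (by norm_cast)
  have hw1 : ContDiff ℝ 1 (curl (v s)) := (hωs s hs).of_le (by norm_cast)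
  have hdivu : VectorCalculus.IsDivFree (v s) := hV.divFree s hs
  have hdivw : VectorCalculus.IsDivFree (curl (v s)) := fun x =>
    divergence_curl_eq_zero_holds (v s) ((hvs s hs).of_le (by norm_cast)) x
  obtain ⟨hTint, hTeq⟩ := integral_G_mul_convect_sub_stretch hv1 hw1 (hBu s hsI) (hBw s hsI) (hMu s hsI) (hMw s hsI)
    hdivu hdivw ht x₀
  -- Green: `∫ (∂ₜG) ω₃ = ∫ G Δω₃`
  have hωd : Differentiable ℝ (curl (v s)) := (hω2 s hs).differentiable two_ne_zero
  have hf1 : ∀ z, ‖fderiv ℝ (fun z => ⟪curl (v s) z, e3⟫) z‖ ≤ Mw := fun z => by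
    refine ContinuousLinearMap.opNorm_le_bound _ ((norm_nonneg _).trans (hMw s hsI z)) fun w => ?_
    rw [fderiv_inner_e3_apply (hωd z), Real.norm_eq_abs]
    exact (abs_inner_e3_le _).trans ((ContinuousLinearMap.le_opNorm _ _).trans
      (mul_le_mul_of_nonneg_right (hMw s hsI z) (norm_nonneg _)))
  have hf2' : ∀ z, ‖fderiv ℝ (fderiv ℝ (fun z => ⟪curl (v s) z, e3⟫)) z‖ ≤ Mw2 := fun z => by
    have e : ‖iteratedFDeriv ℝ 2 (fun z => ⟪curl (v s) z, e3⟫) z‖ =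
        ‖fderiv ℝ (fderiv ℝ (fun z => ⟪curl (v s) z, e3⟫)) z‖ := by
      rw [← norm_iteratedFDeriv_fderiv, ← norm_iteratedFDeriv_fderiv, norm_iteratedFDeriv_zero]
    rw [← e]
    exact (norm_iteratedFDeriv_two_inner_e3_le (hω2 s hs) z).trans (hMw2 s hsI z)
  have hGreen := integral_timeWeight_G_mul_eq (hf2 s hs) hf0 hf1 hf2' ht x₀
  -- integrability of the three pieces of `F' s`
  have Int1 : Integrable (fun x : (EuclideanSpace ℝ (Fin 3)) =>
      ((‖x - x₀‖ ^ 2 / (4 * (s₀ - s) ^ 2) - (3 : ℝ) / (2 * (s₀ - s))) * heatKernel (s₀ - s) (x - x₀)) *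
        ⟪curl (v s) x, e3⟫) := by
    refine (hg16_int.const_mul (Ctw * Bw)).mono' (htwc.mul (hfc s hs)).aestronglyMeasurable (ae_of_all _ fun x => ?_)
    rw [norm_mul, Real.norm_eq_abs, Real.norm_eq_abs]
    calc _ ≤ Ctw * gauss16 x * Bw :=
          mul_le_mul (htwle s hsI x) ((abs_inner_e3_le _).trans (hBw s hsI x)) (abs_nonneg _)
            (mul_nonneg hCtw0 (Real.exp_pos _).le)
      _ = Ctw * Bw * gauss16 x := by ring
  have hΔb : ∀ x, ‖(Δ fun z => ⟪curl (v s) z, e3⟫) x‖ ≤ 3 * Mw2 := fun x =>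
    calc ‖(Δ fun z => ⟪curl (v s) z, e3⟫) x‖ ≤ 3 * ‖iteratedFDeriv ℝ 2 (fun z => ⟪curl (v s) z, e3⟫) x‖ :=
          norm_laplacian_le_three_mul_norm_iteratedFDeriv_two (hf2 s hs) x
      _ ≤ 3 * ‖iteratedFDeriv ℝ 2 (curl (v s)) x‖ := by gcongr; exact norm_iteratedFDeriv_two_inner_e3_le (hω2 s hs) x
      _ ≤ 3 * Mw2 := by gcongr; exact hMw2 s hsI x
  have Int2 : Integrable (fun x : (EuclideanSpace ℝ (Fin 3)) => heatKernel (s₀ - s) (x - x₀) * (Δ fun z => ⟪curl (v s) z, e3⟫) x) :=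
    (integrable_G x₀ ht).mul_bdd (continuous_laplacian (hf2 s hs)).aestronglyMeasurable (ae_of_all _ hΔb)
  have hsplit : (fun x => F' s x) = fun x =>
      -(((‖x - x₀‖ ^ 2 / (4 * (s₀ - s) ^ 2) - (3 : ℝ) / (2 * (s₀ - s))) * heatKernel (s₀ - s) (x - x₀)) *
          ⟪curl (v s) x, e3⟫) +
        (heatKernel (s₀ - s) (x - x₀) * (Δ fun z => ⟪curl (v s) z, e3⟫) x -
          heatKernel (s₀ - s) (x - x₀) * (convect (v s) (curl (v s)) x 2 - convect (curl (v s)) (v s) x 2)) := by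
    funext x; simp only [hF', hD]; ring
  have hval : ∫ x, F' s x =
      (∫ x, fderiv ℝ (fun y : (EuclideanSpace ℝ (Fin 3)) => heatKernel (s₀ - s) (y - x₀)) x (EuclideanSpace.single 0 1) *
            (v s x 0 * curl (v s) x 2 - curl (v s) x 0 * v s x 2)) +
        ∫ x, fderiv ℝ (fun y : (EuclideanSpace ℝ (Fin 3)) => heatKernel (s₀ - s) (y - x₀)) x (EuclideanSpace.single 1 1) *
            (v s x 1 * curl (v s) x 2 - curl (v s) x 1 * v s x 2) := by
    have IntA : Integrable (fun x : (EuclideanSpace ℝ (Fin 3)) =>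
        -(((‖x - x₀‖ ^ 2 / (4 * (s₀ - s) ^ 2) - (3 : ℝ) / (2 * (s₀ - s))) * heatKernel (s₀ - s) (x - x₀)) *
          ⟪curl (v s) x, e3⟫)) := Int1.neg
    have IntB : Integrable (fun x : (EuclideanSpace ℝ (Fin 3)) =>
        heatKernel (s₀ - s) (x - x₀) * (Δ fun z => ⟪curl (v s) z, e3⟫) x -
          heatKernel (s₀ - s) (x - x₀) * (convect (v s) (curl (v s)) x 2 - convect (curl (v s)) (v s) x 2)) :=
      Int2.sub hTint
    rw [show (∫ x, F' s x) = ∫ x, (fun x => F' s x) x from rfl, hsplit,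
      integral_add IntA IntB, integral_neg, integral_sub Int2 hTint, hGreen, hTeq]
    ring
  rw [hval] at hD'
  exact hD'

/-- **DYNAMIC GAUSSIAN VORTICITY LAW ON THE DOOR CLASS.**  For every profile of the Type-I ancient Oseen-mild class (the
hypothesis block of `HemisphereLiouvilleE3`), every space–time axis datum `(x₀, s₀)` and every `s < min(0, s₀)`:
`d/ds ∫ G_{s₀−s}(x − x₀) ω₃(s,x) dx = ∫ ∂₀G F₀ + ∫ ∂₁G F₁`, `Fⱼ = vⱼω₃ − ωⱼv₃` — NO sign hypothesis, time-only class,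
absolutely convergent.  (Class ⇒ classical vorticity solution `…ClassDerivDecay.exists_classical_of_class`; class rates
`…ClassSpaceTimeRates`; then `hasDerivAt_gaussVorticity_time`.) -/
theorem hasDerivAt_gaussVorticity_of_class :
    ∀ (C : ℝ) (v : ℝ → EuclideanSpace ℝ (Fin 3) → EuclideanSpace ℝ (Fin 3)),
    Literature.Analysis.FluidPDE.HasTypeITimeDecay C v →
    ContinuousOn (Function.uncurry v) (Set.Iio (0 : ℝ) ×ˢ Set.univ) →
    (∀ s t : ℝ, s < t → t < 0 → ∀ x, v t x =
      Literature.Analysis.UnboundedOperators.heatExtension (v s) (t - s) x -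
        Literature.Analysis.FluidPDE.oseenDuhamel 1 s v v t x) →
    (∀ t < 0, Literature.Analysis.FluidPDE.VectorCalculus.IsDivFree (v t)) →
    ∀ (x₀ : (EuclideanSpace ℝ (Fin 3))) (s₀ s : ℝ), s < 0 → s < s₀ →
      HasDerivAt (fun σ => ∫ x, heatKernel (s₀ - σ) (x - x₀) * ⟪curl (v σ) x, e3⟫)
        ((∫ x, fderiv ℝ (fun y : (EuclideanSpace ℝ (Fin 3)) => heatKernel (s₀ - s) (y - x₀)) x (EuclideanSpace.single 0 1) *
              (v s x 0 * curl (v s) x 2 - curl (v s) x 0 * v s x 2)) +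
          ∫ x, fderiv ℝ (fun y : (EuclideanSpace ℝ (Fin 3)) => heatKernel (s₀ - s) (y - x₀)) x (EuclideanSpace.single 1 1) *
              (v s x 1 * curl (v s) x 2 - curl (v s) x 1 * v s x 2)) s := by
  intro C v hrate hcont hmild hdiv x₀ s₀ s hs hs₀
  -- the class is classical, hence a vorticity solution
  obtain ⟨q, hcl⟩ := exists_classical_of_class hrate hcont hmild hdiv
  have hV : IsVorticitySolutionOn (Iio (0 : ℝ)) 1 v :=
    hcl.isVorticitySolutionOn_zero_force isOpen_Iio.uniqueDiffOn (by rw [interior_Iio]; exact subset_closure)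
  -- class rates
  obtain ⟨K₁, hK₁0, hK₁⟩ := exists_fderiv_rate_of_class' hrate hcont hmild
  obtain ⟨K₂, hK₂0, hK₂⟩ := exists_iteratedFDeriv_two_rate_of_class' hrate hcont hmild
  obtain ⟨K₃, hK₃0, hK₃⟩ := exists_iteratedFDeriv_three_rate_of_class hrate hcont hmild
  have hC0 : 0 ≤ C := by
    have h := hrate (-1) (by norm_num) 0
    rw [neg_neg, Real.sqrt_one, div_one] at h
    exact (norm_nonneg _).trans h
  -- the neighbourhood `(s − δ, s + δ)`, `δ = min(−s/2, (s₀−s)/2)`, where `−σ ≥ m := −s/2`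
  set δ : ℝ := min (-s / 2) ((s₀ - s) / 2) with hδ
  have hδ0 : 0 < δ := by
    rw [hδ]; exact lt_min (by linarith) (by linarith)
  have hδ1 : δ ≤ -s / 2 := min_le_left _ _
  have hδ2 : δ ≤ (s₀ - s) / 2 := min_le_right _ _
  have hδs : s + δ < 0 := by linarith
  have hδt : 2 * δ ≤ s₀ - s := by linarith
  set m : ℝ := -s / 2 with hm
  have hm0 : 0 < m := by rw [hm]; linarith
  have hms : ∀ σ ∈ Ioo (s - δ) (s + δ), m ≤ -σ ∧ σ < 0 := by
    intro σ hσ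
    constructor
    · rw [hm]; linarith [hσ.2]
    · linarith [hσ.2]
  have hsm : ∀ σ ∈ Ioo (s - δ) (s + δ), ContDiff ℝ 3 (v σ) := by
    intro σ hσ
    have hA := analyticOnNhd_slice hcont (bdd_of_hasTypeITimeDecay hrate) hmild (hms σ hσ).2
    exact contDiff_iff_contDiffAt.2 fun x => (hA x (mem_univ x)).contDiffAt
  -- uniform bounds on the neighbourhood
  have hBu : ∀ σ ∈ Ioo (s - δ) (s + δ), ∀ x, ‖v σ x‖ ≤ C / Real.sqrt m := by
    intro σ hσ x
    obtain ⟨hle, hσ0⟩ := hms σ hσ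
    exact (hrate σ hσ0 x).trans (div_le_div_of_nonneg_left hC0 (Real.sqrt_pos.2 hm0) (Real.sqrt_le_sqrt hle))
  have hMu : ∀ σ ∈ Ioo (s - δ) (s + δ), ∀ x, ‖fderiv ℝ (v σ) x‖ ≤ K₁ / m := by
    intro σ hσ x
    obtain ⟨hle, hσ0⟩ := hms σ hσ
    exact (hK₁ σ hσ0 x).trans (div_le_div_of_nonneg_left hK₁0 hm0 hle)
  have hBw : ∀ σ ∈ Ioo (s - δ) (s + δ), ∀ x, ‖curl (v σ) x‖ ≤ 4 * (K₁ / m) := fun σ hσ x =>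
    (norm_curl_le_four_mul (v σ) x).trans (mul_le_mul_of_nonneg_left (hMu σ hσ x) (by norm_num))
  have hMw : ∀ σ ∈ Ioo (s - δ) (s + δ), ∀ x, ‖fderiv ℝ (curl (v σ)) x‖ ≤ ‖curlCLM‖ * (K₂ / (m * Real.sqrt m)) := by
    intro σ hσ x
    obtain ⟨hle, hσ0⟩ := hms σ hσ
    refine (FluidPDE.norm_fderiv_curl_le ((hsm σ hσ).of_le (by norm_cast)) x).trans
      (mul_le_mul_of_nonneg_left ?_ (norm_nonneg curlCLM))
    refine (hK₂ σ hσ0 x).trans (div_le_div_of_nonneg_left hK₂0 (by positivity) ?_)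
    exact mul_le_mul hle (Real.sqrt_le_sqrt hle) (Real.sqrt_nonneg _) (by linarith)
  have hMw2 : ∀ σ ∈ Ioo (s - δ) (s + δ), ∀ x, ‖iteratedFDeriv ℝ 2 (curl (v σ)) x‖ ≤ ‖curlCLM‖ * (K₃ / m ^ 2) := by
    intro σ hσ x
    obtain ⟨hle, hσ0⟩ := hms σ hσ
    refine (FluidPDE.norm_iteratedFDeriv_two_curl_le (hsm σ hσ) x).trans (mul_le_mul_of_nonneg_left ?_ (norm_nonneg curlCLM))
    refine (hK₃ σ hσ0 x).trans (div_le_div_of_nonneg_left hK₃0 (by positivity) ?_)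
    exact pow_le_pow_left₀ hm0.le hle 2
  exact hasDerivAt_gaussVorticity_time hV hδ0 hδs hs₀ hδt hBu hMu hBw hMw hMw2 x₀

end Dynamic

end Summit.NavierStokesRegularity.NavierStokesRegularity.Theorems.HalfSpaceWindowDoorCirculationCarryingRigidityGaussVorticityLaw

end
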